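import Mathlib
import Literature.AlgebraicGeometry.Resolution.AffineBlowupAlgebra
import Literature.AlgebraicGeometry.Resolution.AffineBlowupCartier

/-!
# `SectionCriterion` (stmt-ResolutionOfSingularities-15962), helper: charts and stalks of `Bl_I(Spec A)` in algebra

Route `ResolutionOfSingularities/SectionAscent`, support item `SectionCriterion`. Wrappers turning
statements about points and stalks of the affine blowing up `affineBlowup I = Proj A[It]` into statements
about primes and localisations of the affine blowup algebras `A[I/b] ⊆ A[1/b]`
(`Literature.AlgebraicGeometry.Resolution.blowupAlgebra`, `reesChartEquiv`):

* `exists_stalk_ringEquiv_localization_blowupAlgebra` — the stalk at a point of the chart `D₊(bt)` is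
  `(A[I/b])_P`;
* `isIntegrallyClosed_blowupAlgebra_of_stalk`, `isRegularLocalRing_localization_blowupAlgebra` —
  transport of normality / regularity;
* `exists_primes_blowupAlgebra_of_specializes` — a proper specialisation `y ⤳ z` inside a fibre of
  `π : Bl_I(Spec A) → Spec A` gives, in a chart `D₊(gt) ∋ z`, primes `Q < Q'` of `A[I/g]` over the same
  prime of `A`, with `𝒪_{Bl,y} ≅ (A[I/g])_Q`.

Proved by the wave-1 stub-worker of line `registered` of crux `GenericLevel` (stmt-…-15959); sorry-free,
no named facts. [folklore] throughout (Stacks 0804 for the charts).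
-/

set_option linter.dupNamespace false

open AlgebraicGeometry CategoryTheory Literature.AlgebraicGeometry.Resolution

namespace Summit.ResolutionOfSingularities.ResolutionOfSingularities.Theorems

universe u

/-- Transport of localizations at primes along a ring isomorphism: `A_{e⁻¹ p} ≅ A'_p`.
[folklore] -/
theorem nonempty_ringEquiv_localization_comap {A A' : Type u} [CommRing A] [CommRing A']
    (f : A →+* A') (hf : Function.Bijective f) (p : Ideal A') [p.IsPrime] :
    Nonempty (Localization.AtPrime (p.comap f) ≃+* Localization.AtPrime p) := by
  -- adapted from `mem_regularLocus_iff_of_ringEquiv` (JacobianRegularLocus.lean)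
  let e := RingEquiv.ofBijective f hf
  have H : (p.comap f).primeCompl.map e.toMonoidHom = p.primeCompl := by
    ext x
    simp only [Submonoid.mem_map]
    constructor
    · rintro ⟨y, hy, rfl⟩
      exact hy
    · intro hx
      refine ⟨e.symm x, fun h => hx ?_, e.apply_symm_apply x⟩
      rw [SetLike.mem_coe, Ideal.mem_comap] at h
      change e (e.symm x) ∈ p at h
      rwa [e.apply_symm_apply] at h
  exact ⟨IsLocalization.ringEquivOfRingEquiv (Localization.AtPrime (p.comap f))
    (Localization.AtPrime p) e H⟩

/-- **Stalks of the blowing up at points of the chart `D₊(bt)` are the local rings of the affine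
blowup algebra `R[I/b]`**: for a prime `P` of `R[I/b]` (`b ∈ I`), the stalk of `Bl_I(Spec R)` at
the corresponding point of the chart is `R[I/b]_P` (open immersion `chartι`, `Spec.stalkIso`,
`reesChartEquiv`). [cite: StacksProject, Tag 0804] -/
theorem exists_stalk_ringEquiv_localization_blowupAlgebra {R : Type u} [CommRing R]
    {I : Ideal R} (b : R) (hb : b ∈ I) (P : Ideal (blowupAlgebra I b)) [P.IsPrime] :
    ∃ y : ↥(affineBlowup I), (affineBlowup.π I).base y =
        PrimeSpectrum.comap (algebraMap R (blowupAlgebra I b)) ⟨P, inferInstance⟩ ∧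
      Nonempty (((affineBlowup I).presheaf.stalk y) ≃+* Localization.AtPrime P) := by
  let f : HomogeneousLocalization.Away (reesGrading I) (reesT b hb) →+* blowupAlgebra I b :=
    (reesChartEquiv (I := I) b hb).toRingHom
  have hf : Function.Bijective f :=
    ⟨fun x y h => (reesChartEquiv b hb).injective h, fun z => (reesChartEquiv b hb).surjective z⟩
  let q : PrimeSpectrum (HomogeneousLocalization.Away (reesGrading I) (reesT b hb)) :=
    ⟨P.comap f, inferInstance⟩
  refine ⟨(affineBlowup.chartι (I := I) b hb).base q, ?_, ?_⟩
  · change ((affineBlowup.chartι (I := I) b hb) ≫ affineBlowup.π I).base q = _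
    rw [affineBlowup.chartι_π]
    change PrimeSpectrum.comap (reesChartBase b hb) q = _
    ext1
    change (P.comap f).comap (reesChartBase b hb) = P.comap (algebraMap R (blowupAlgebra I b))
    rw [Ideal.comap_comap, ← reesChartEquiv_comp_reesChartBase b hb]
  · obtain ⟨e'⟩ := nonempty_ringEquiv_localization_comap
      (A := HomogeneousLocalization.Away (reesGrading I) (reesT b hb)) (A' := blowupAlgebra I b) f hf P
    exact ⟨((asIso ((affineBlowup.chartι (I := I) b hb).stalkMap q)).commRingCatIsoToRingEquiv.trans
      (Spec.stalkIso (CommRingCat.of (HomogeneousLocalization.Away (reesGrading I) (reesT b hb)))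
        q).commRingCatIsoToRingEquiv).trans e'⟩

/-- Normality of the blowing up passes to the affine blowup algebras: if all stalks of
`Bl_I(Spec R)` (`R` a domain, `0 ≠ b ∈ I`) are integrally closed then `R[I/b]` is integrally
closed (`IsIntegrallyClosed` is local, Mathlib `IsIntegrallyClosed.of_localization_maximal`).
[folklore] -/
theorem isIntegrallyClosed_blowupAlgebra_of_stalk {R : Type u} [CommRing R] [IsDomain R]
    {I : Ideal R} (b : R) (hb : b ∈ I) (hb0 : b ≠ 0)
    (hnorm : ∀ y : ↥(affineBlowup I), IsIntegrallyClosed ((affineBlowup I).presheaf.stalk y)) :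
    IsIntegrallyClosed (blowupAlgebra I b) := by
  haveI : IsDomain (Localization.Away b) :=
    IsLocalization.isDomain_localization (powers_le_nonZeroDivisors_of_noZeroDivisors hb0)
  refine IsIntegrallyClosed.of_localization_maximal fun p _ hp => ?_
  obtain ⟨y, -, ⟨e⟩⟩ := exists_stalk_ringEquiv_localization_blowupAlgebra (I := I) b hb p
  haveI := hnorm y
  exact IsIntegrallyClosed.of_equiv e

/-- Regularity of the blowing up passes to the local rings of the affine blowup algebras.
[folklore] -/
theorem isRegularLocalRing_localization_blowupAlgebra {R : Type u} [CommRing R] {J : Ideal R}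
    (b : R) (hb : b ∈ J) (hreg : Scheme.IsRegular (affineBlowup J))
    (P : Ideal (blowupAlgebra J b)) [P.IsPrime] : IsRegularLocalRing (Localization.AtPrime P) := by
  obtain ⟨y, -, ⟨e⟩⟩ := exists_stalk_ringEquiv_localization_blowupAlgebra (I := J) b hb P
  haveI := hreg y
  exact IsRegularLocalRing.of_ringEquiv e

/-- `a t = 0` in `R[It]` when `a = 0`. [folklore] -/
theorem reesT_eq_zero' {R : Type u} [CommRing R] {I : Ideal R} (a : R) (ha : a ∈ I) (h0 : a = 0) :
    reesT a ha = 0 := by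
  -- adapted from Theorems/FrobeniusLadderFInjectiveMacaulayficationStalkChartIso.lean
  apply Subtype.ext
  rw [coe_reesT, h0, map_zero]
  rfl

/-- **A point of the blowing up that is not closed in its fibre, read in a chart.** If `y ⤳ z`,
`z ≠ y` and `π z = π y` in `Bl_I(Spec R)`, then for some `0 ≠ g ∈ I` both points lie in the chart
`D₊(gt) = Spec R[I/g]`, at primes `Q < Q'` of `R[I/g]` over the same prime of `R`, and the stalk
at `y` is `R[I/g]_Q`. [cite: StacksProject, Tag 0804] -/
theorem exists_primes_blowupAlgebra_of_specializes {R : Type u} [CommRing R] {I : Ideal R}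
    (y z : ↥(affineBlowup I)) (hne : z ≠ y) (hsp : y ⤳ z)
    (hπ : (affineBlowup.π I).base z = (affineBlowup.π I).base y) :
    ∃ (g : R) (_ : g ∈ I), g ≠ 0 ∧ ∃ Q Q' : PrimeSpectrum (blowupAlgebra I g), Q < Q' ∧
      Q.asIdeal.comap (algebraMap R (blowupAlgebra I g)) =
        Q'.asIdeal.comap (algebraMap R (blowupAlgebra I g)) ∧
      Nonempty (((affineBlowup I).presheaf.stalk y) ≃+* Localization.AtPrime Q.asIdeal) := by
  -- a chart containing `z`, hence `y`
  have hz : z ∈ (⨆ b : I, Proj.basicOpen (reesGrading I) (reesT (I := I) b.1 b.2)) := by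
    rw [affineBlowup.iSup_basicOpen_reesT_eq_top]; trivial
  obtain ⟨⟨g, hg⟩, hzg⟩ := TopologicalSpace.Opens.mem_iSup.mp hz
  have hyg : y ∈ Proj.basicOpen (reesGrading I) (reesT (I := I) g hg) :=
    hsp.mem_open (Proj.basicOpen (reesGrading I) (reesT (I := I) g hg)).2 hzg
  have hg0 : g ≠ 0 := by
    intro h0
    rw [reesT_eq_zero' g hg h0, Proj.basicOpen_zero] at hzg
    exact hzg
  -- the points of the chart
  let ι := affineBlowup.chartι (I := I) g hg
  have hrange : ι.opensRange = Proj.basicOpen (reesGrading I) (reesT (I := I) g hg) :=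
    Proj.opensRange_awayι _ _ _ _
  rw [← hrange] at hzg hyg
  obtain ⟨q, rfl⟩ := Scheme.Hom.mem_opensRange.mp hyg
  obtain ⟨q', rfl⟩ := Scheme.Hom.mem_opensRange.mp hzg
  have hle : q.asIdeal ≤ q'.asIdeal :=
    (PrimeSpectrum.le_iff_specializes q q').mpr (ι.isOpenEmbedding.isInducing.specializes_iff.mp hsp)
  have hne' : q ≠ q' := by
    rintro rfl
    exact hne rfl
  have hcomap : q.asIdeal.comap (reesChartBase g hg) = q'.asIdeal.comap (reesChartBase g hg) := by
    have h1 : (ι ≫ affineBlowup.π I).base q = (ι ≫ affineBlowup.π I).base q' := by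
      change (affineBlowup.π I).base (ι.base q) = (affineBlowup.π I).base (ι.base q')
      exact hπ.symm
    rw [affineBlowup.chartι_π] at h1
    exact congrArg PrimeSpectrum.asIdeal h1
  -- transport to `R[I/g]`
  let f : HomogeneousLocalization.Away (reesGrading I) (reesT g hg) →+* blowupAlgebra I g :=
    (reesChartEquiv (I := I) g hg).toRingHom
  let f' : blowupAlgebra I g →+* HomogeneousLocalization.Away (reesGrading I) (reesT g hg) :=
    (reesChartEquiv (I := I) g hg).symm.toRingHom
  have hf' : Function.Bijective f' :=
    ⟨fun x y h => (reesChartEquiv g hg).symm.injective h,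
      fun z => (reesChartEquiv g hg).symm.surjective z⟩
  let Q : PrimeSpectrum (blowupAlgebra I g) := ⟨q.asIdeal.comap f', inferInstance⟩
  let Q' : PrimeSpectrum (blowupAlgebra I g) := ⟨q'.asIdeal.comap f', inferInstance⟩
  have hback : ∀ p : Ideal (HomogeneousLocalization.Away (reesGrading I) (reesT g hg)),
      (p.comap f').comap f = p := by
    intro p
    rw [Ideal.comap_comap]
    convert Ideal.comap_id p
    exact RingHom.ext fun x => (reesChartEquiv g hg).symm_apply_apply x
  have hsymm : f'.comp (algebraMap R (blowupAlgebra I g)) = reesChartBase g hg := by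
    refine RingHom.ext fun r => ?_
    have h := congrArg (reesChartEquiv (I := I) g hg).symm (reesChartEquiv_reesChartBase (I := I) g hg r)
    rw [RingEquiv.symm_apply_apply] at h
    exact h.symm
  refine ⟨g, hg, hg0, Q, Q', ?_, ?_, ?_⟩
  · change Q.asIdeal < Q'.asIdeal
    refine lt_of_le_of_ne (Ideal.comap_mono hle) fun h => hne' ?_
    apply PrimeSpectrum.ext
    rw [← hback q.asIdeal, ← hback q'.asIdeal]
    exact congrArg (Ideal.comap f) h
  · change (q.asIdeal.comap _).comap _ = (q'.asIdeal.comap _).comap _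
    rw [Ideal.comap_comap, Ideal.comap_comap, hsymm, hcomap]
  · obtain ⟨e'⟩ := nonempty_ringEquiv_localization_comap f' hf' q.asIdeal
    exact ⟨((asIso (ι.stalkMap q)).commRingCatIsoToRingEquiv.trans
      (Spec.stalkIso (.of _) q).commRingCatIsoToRingEquiv).trans e'.symm⟩

end Summit.ResolutionOfSingularities.ResolutionOfSingularities.Theorems
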